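import Literature.AlgebraicGeometry.Motives.CechH1OfSheafCohomology
import Literature.AlgebraicGeometry.Motives.FlasqueCohomology
import Literature.AlgebraicGeometry.Modules.LocalExactness
import Mathlib.Algebra.Homology.DerivedCategory.Ext.ExactSequences
import Mathlib.CategoryTheory.Sites.SheafCohomology.Basic
import Mathlib.Topology.Sheaves.LocallySurjective
import Mathlib.AlgebraicGeometry.AffineScheme

/-!
# `H¹(X, 𝒪_X) → H¹(X, F)` is onto for a quotient `F = 𝒪_X / q` when `H²(X, 𝒪_X)` has no `q`-torsion

Stub `stub_h1MapSurjective` of the line `IdeatorFiveSketch` (crux `FormalLiftingFromClassLifting`):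
for a scheme `X`, a natural number `q` acting injectively on the functions over affine opens, and a
morphism of abelian sheaves `r : 𝒪_X → F` which over every affine open is surjective with kernel
`q · Γ`, the sequence `0 → 𝒪_X →(q) 𝒪_X →(r) F → 0` is short exact in
`Sheaf (Opens.grothendieckTopology X) Ab`, and the long exact `Ext`-sequence
`H¹(X, 𝒪_X) → H¹(X, F) →(δ) H²(X, 𝒪_X) →(q) H²(X, 𝒪_X)` shows that `H¹(r)` is onto as soon as
`H²(X, 𝒪_X)` has no `q`-torsion.
-/

set_option linter.dupNamespace false

namespace Summit.HodgeConjecture.HodgeConjecture.Theorems.FormalLiftingFromClassLifting.WeightOne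

open CategoryTheory AlgebraicGeometry Opposite TopologicalSpace Literature.AlgebraicGeometry.Motives
open Abelian

universe u

section General

variable {Y : TopCat.{u}}

/-- Sections of an integer multiple of a morphism of abelian sheaves: `(q • f)(s) = q • f(s)`. -/
private theorem nsmul_hom_app_apply {G G' : Sheaf (Opens.grothendieckTopology Y) AddCommGrpCat.{u}}
    (f : G ⟶ G') (q : ℕ) (U : (Opens Y)ᵒᵖ) (s : G.obj.obj U) :
    (q • f).hom.app U s = q • f.hom.app U s := by
  induction q with
  | zero => simp
  | succ q ih => simp [succ_nsmul, ih]

/-- `Hⁿ(q • f) = q • Hⁿ(f)` on Mathlib's sheaf cohomology `Sheaf.H`. -/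
private theorem H_map_nsmul_apply {G G' : Sheaf (Opens.grothendieckTopology Y) AddCommGrpCat.{u}}
    (f : G ⟶ G') (q : ℕ) (n : ℕ) (x : G.H n) :
    Sheaf.H.map (q • f) n x = q • Sheaf.H.map f n x := by
  induction q with
  | zero => simp [Sheaf.H.map_apply]
  | succ q ih => simp [succ_nsmul, ih]

/-- Surjectivity of `H¹(g)` from the long exact `Ext`-sequence: for a short exact
`0 → X₁ →(f) X₂ →(g) X₃ → 0` of abelian sheaves such that every class `z ∈ H²(X₁)` with
`H²(f)(z) = 0` vanishes, `H¹(g) : H¹(X₂) → H¹(X₃)` is surjective. -/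
private theorem H_one_map_surjective_of_shortExact
    {S : ShortComplex (Sheaf (Opens.grothendieckTopology Y) AddCommGrpCat.{u})} (hS : S.ShortExact)
    (hf : ∀ z : S.X₁.H 2, Sheaf.H.map S.f 2 z = 0 → z = 0) :
    Function.Surjective (Sheaf.H.map S.g 1) := by
  intro y
  have hz : y.comp hS.extClass (rfl : 1 + 1 = 2) = 0 := by
    apply hf
    rw [Sheaf.H.map_apply, Ext.comp_assoc_of_third_deg_zero, hS.extClass_comp, Ext.comp_zero]
  obtain ⟨x, hx⟩ := Ext.covariant_sequence_exact₃ _ hS y rfl hz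
  exact ⟨x, hx⟩

end General

section Scheme

variable {X : Scheme.{u}}

/-- Locality against affine opens: a section of an abelian sheaf on a scheme vanishing on every
affine open contained in its domain is zero (affine opens form a basis). -/
private theorem eq_zero_of_map_affine_eq_zero
    (G : Sheaf (Opens.grothendieckTopology X) AddCommGrpCat.{u}) (U : X.Opens)
    (t : G.obj.obj (op U))
    (h : ∀ V : X.Opens, IsAffineOpen V → ∀ hVU : V ≤ U, G.obj.map (homOfLE hVU).op t = 0) :
    t = 0 := by
  apply TopCat.Sheaf.eq_of_locally_eq' (C := AddCommGrpCat.{u}) G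
    (fun V : {V : X.Opens // IsAffineOpen V ∧ V ≤ U} => V.1) U (fun V => homOfLE V.2.2)
  · intro x hx
    obtain ⟨V, hV, hxV, hVU⟩ := Opens.isBasis_iff_nbhd.mp X.isBasis_affineOpens hx
    exact Opens.mem_iSup.mpr ⟨⟨V, hV, hVU⟩, hxV⟩
  · intro V
    rw [map_zero]
    exact h V.1 V.2.1 V.2.2

end Scheme

/-- **S1 (`H¹` surjectivity from torsion-freeness of `H²`).** On a scheme `X`, let `q` act
injectively on the functions over affine opens and let `H²(X, 𝒪_X)` have no `q`-torsion. Then for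
every morphism of abelian sheaves `r : 𝒪_X → F` which, over every affine open, is surjective with
kernel `q·Γ`, the induced map `H¹(X, 𝒪_X) → H¹(X, F)` is surjective (long exact `Ext`-sequence of
`0 → 𝒪 →(q) 𝒪 → F → 0`: the next map is `q : H²(𝒪) → H²(𝒪)`, injective). -/
theorem stub_h1MapSurjective :
    ∀ (X : Scheme.{u}) (q : ℕ),
      (∀ U : X.Opens, IsAffineOpen U →
        ∀ s : (structureSheafAb X).obj.obj (op U), q • s = 0 → s = 0) →
      (∀ x : structureSheafCohomology X 2, (q : ℤ) • x = 0 → x = 0) →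
      ∀ (F : Sheaf (Opens.grothendieckTopology X) AddCommGrpCat.{u}) (r : structureSheafAb X ⟶ F),
        (∀ U : X.Opens, IsAffineOpen U → Function.Surjective (r.hom.app (op U))) →
        (∀ U : X.Opens, IsAffineOpen U → ∀ s : (structureSheafAb X).obj.obj (op U),
          r.hom.app (op U) s = 0 ↔ ∃ t : (structureSheafAb X).obj.obj (op U), s = q • t) →
        Function.Surjective (Sheaf.H.map r 1 : Sheaf.H.{u} (structureSheafAb X) 1 → Sheaf.H.{u} F 1) := by
  intro X q hq htors F r hr hker
  -- naturality of `r` on sections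
  have hnat : ∀ {V W : X.Opens} (hVW : V ≤ W) (s : (structureSheafAb X).obj.obj (op W)),
      F.obj.map (homOfLE hVW).op (r.hom.app (op W) s) =
        r.hom.app (op V) ((structureSheafAb X).obj.map (homOfLE hVW).op s) := by
    intro V W hVW s
    rw [← CategoryTheory.comp_apply, ← r.hom.naturality, CategoryTheory.comp_apply]
  -- (1) `r ∘ q = 0` (true on affine opens, hence everywhere by locality of `F`)
  have hzero : (q • 𝟙 (structureSheafAb X)) ≫ r = 0 := by
    ext U s
    have e0 : (0 : structureSheafAb X ⟶ F).hom.app U s = 0 := by simp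
    refine Eq.trans ?_ e0.symm
    change r.hom.app U ((q • 𝟙 (structureSheafAb X)).hom.app U s) = 0
    rw [nsmul_hom_app_apply]
    change r.hom.app (op U.unop) (q • s) = 0
    apply eq_zero_of_map_affine_eq_zero F U.unop
    intro V hV hVU
    rw [hnat hVU, map_nsmul]
    exact (hker V hV _).mpr ⟨_, rfl⟩
  -- (2) the short exact sequence `0 → 𝒪 →(q) 𝒪 →(r) F → 0`
  have hS : (ShortComplex.mk (q • 𝟙 (structureSheafAb X)) r hzero).ShortExact := by
    refine ShortComplex.ShortExact.mk' ?_ ?_ ?_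
    · -- exactness in the middle is local; on affine opens it is the hypothesis `ker r = q Γ`
      refine Literature.AlgebraicGeometry.Modules.sheaf_exact_of_locally_exact
        (ShortComplex.mk (C := TopCat.Sheaf AddCommGrpCat.{u} X) (q • 𝟙 (structureSheafAb X)) r
          hzero)
        fun V s hs y hy => ?_
      obtain ⟨W, hW, hyW, hWV⟩ := Opens.isBasis_iff_nbhd.mp X.isBasis_affineOpens hy
      have hsW : r.hom.app (op W) ((structureSheafAb X).obj.map (homOfLE hWV).op s) = 0 := by
        rw [← hnat hWV]
        change F.obj.map (homOfLE hWV).op (r.hom.app (op V) s) = 0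
        rw [hs, map_zero]
      obtain ⟨t, ht⟩ := (hker W hW _).mp hsW
      refine ⟨W, homOfLE hWV, hyW, t, ?_⟩
      change (q • 𝟙 (structureSheafAb X)).hom.app (op W) t =
        (structureSheafAb X).obj.map (homOfLE hWV).op s
      rw [nsmul_hom_app_apply, ht]
      rfl
    · -- `q` is injective on sections (true on affine opens, hence everywhere by locality)
      refine (Sheaf.Hom.mono_iff_presheaf_mono _ _ _).mpr
        ((NatTrans.mono_iff_mono_app _).mpr fun U => ?_)
      rw [AddCommGrpCat.mono_iff_injective, injective_iff_map_eq_zero]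
      intro s hs
      have hs' : q • s = 0 := by
        have e : (q • 𝟙 (structureSheafAb X)).hom.app U s = 0 := hs
        rw [nsmul_hom_app_apply] at e
        exact e
      apply eq_zero_of_map_affine_eq_zero (structureSheafAb X) U.unop
      intro V hV hVU
      apply hq V hV
      rw [← map_nsmul]
      change (structureSheafAb X).obj.map (homOfLE hVU).op (q • s) = 0
      rw [hs', map_zero]
    · -- `r` is locally surjective
      refine (TopCat.Sheaf.isLocallySurjective_iff_epi r).mp ?_
      rw [TopCat.Presheaf.isLocallySurjective_iff]
      intro U t x hx
      obtain ⟨V, hV, hxV, hVU⟩ := Opens.isBasis_iff_nbhd.mp X.isBasis_affineOpens hx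
      obtain ⟨s, hs⟩ := hr V hV (F.obj.map (homOfLE hVU).op t)
      exact ⟨V, hVU, ⟨s, hs⟩, hxV⟩
  -- (3) the long exact `Ext`-sequence: `δ y ∈ H²(X, 𝒪_X)` is killed by `q`, hence vanishes
  have key : Function.Surjective
      (Sheaf.H.map (ShortComplex.mk (q • 𝟙 (structureSheafAb X)) r hzero).g 1) := by
    refine H_one_map_surjective_of_shortExact hS fun z hz => htors z ?_
    have hz' : Sheaf.H.map (q • 𝟙 (structureSheafAb X)) 2 z = 0 := hz
    rw [H_map_nsmul_apply, Sheaf.H.map_id_apply] at hz'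
    rw [natCast_zsmul]
    exact hz'
  intro y
  obtain ⟨x, hx⟩ := key y
  exact ⟨x, hx⟩

end Summit.HodgeConjecture.HodgeConjecture.Theorems.FormalLiftingFromClassLifting.WeightOne
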